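import Mathlib
import Literature.NumberTheory.Transcendental.LinEDS
import Literature.NumberTheory.Transcendental.LinEDSCode
import Literature.NumberTheory.Transcendental.MZVWordShuffle
import HarnessLib

/-!
# `KernelModuloPeriodConjecture`, line `Sketch`: insertions of `y` are the shuffle with `y` (E4)

Crux `FurushoPentagon.KernelModuloPeriodConjecture` (stmt-KontsevichZagierPeriods-15058), line
`Sketch`, registered stub `stub_insY_count` (E4 of the soundness chain of the kernel-checkable
GF(2) engine `LinEDS` for the linearised extended double shuffle system).

Words over `{x, y} = {false, true}` are coded as numbers by `LinEDS.code` (first letter = most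
significant bit), and the engine folds a divergent word `y x u` into the words `x v`,
`v ∈ y ш u`, computing the insertions of one `y` into `u` arithmetically:
`LinEDS.insY (code u) j` inserts a `1`-bit above the `j` lowest bits. We prove that the `|u| + 1`
numbers `insY (code u) j`, `j = 0, …, |u|`, are, WITH MULTIPLICITY, the codes of the `|u| + 1`
interleavings listed by `MZV.shuffleWord [true] u`.

## Proof

Arithmetic: `insY u j = 2^j (2 ⌊u / 2^j⌋ + 1) + u mod 2^j` (the three `|||` are disjoint sums),
whence `insY u j = 2^j + u` for `u < 2^j` (insertion on top) and
`insY (a 2^m + u) j = a 2^(m+1) + insY u j` for `j ≤ m` (a top letter commutes with a lower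
insertion). Then by induction on `u = b :: u'` (`n = |u'|`): splitting
`range (n+2) = range (n+1) ++ [n+1]` and `y ш (b u') = [y b u'] ++ b (y ш u')`, the last insertion
is `code (y b u')` and the first `n+1` are `b.toNat 2^(n+1) +` the insertions into `u'`, which by
induction are a permutation of the codes of `y ш u'`, shifted by the same amount as
`code (b :: v) = b.toNat 2^(n+1) + code v`. A permutation has the same counts. [folklore]
-/

namespace Summit.KontsevichZagierPeriods.FurushoPentagon.KernelModuloPeriodConjecture

open Literature.NumberTheory.Transcendental

open LinEDS

/-- Closed form of the insertion: `insY u j = 2^j (2 ⌊u/2^j⌋ + 1) + u mod 2^j`. [folklore] -/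
theorem insYE4_insY_eq (u j : ℕ) :
    LinEDS.insY u j = 2 ^ j * (2 * (u / 2 ^ j) + 1) + u % 2 ^ j := by
  have h1 : 2 ^ (j + 1) * (u / 2 ^ j) + 2 ^ j = 2 ^ (j + 1) * (u / 2 ^ j) ||| 2 ^ j :=
    Nat.two_pow_add_eq_or_of_lt (Nat.pow_lt_pow_right (by norm_num) (Nat.lt_succ_self j)) _
  have h2 : 2 ^ j * (2 * (u / 2 ^ j) + 1) + u % 2 ^ j =
      2 ^ j * (2 * (u / 2 ^ j) + 1) ||| u % 2 ^ j :=
    Nat.two_pow_add_eq_or_of_lt (Nat.mod_lt _ (Nat.two_pow_pos j)) _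
  have h3 : 2 ^ (j + 1) * (u / 2 ^ j) + 2 ^ j = 2 ^ j * (2 * (u / 2 ^ j) + 1) := by
    rw [pow_succ]; ring
  rw [LinEDS.insY, Nat.shiftLeft_eq, Nat.shiftRight_eq_div_pow,
    Nat.mul_comm (u / 2 ^ j) (2 ^ (j + 1)), ← h1, h3, ← h2]

/-- Insertion on top: `insY u j = 2^j + u` when `u < 2^j`. [folklore] -/
theorem insYE4_insY_of_lt {u j : ℕ} (h : u < 2 ^ j) : LinEDS.insY u j = 2 ^ j + u := by
  rw [insYE4_insY_eq, Nat.div_eq_of_lt h, Nat.mod_eq_of_lt h]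
  ring

/-- A top letter commutes with a lower insertion: `insY (a 2^m + u) j = a 2^(m+1) + insY u j` for
`j ≤ m`. [folklore] -/
theorem insYE4_insY_add (a m u j : ℕ) (hj : j ≤ m) :
    LinEDS.insY (a * 2 ^ m + u) j = a * 2 ^ (m + 1) + LinEDS.insY u j := by
  obtain ⟨d, rfl⟩ := Nat.exists_eq_add_of_le hj
  rw [insYE4_insY_eq, insYE4_insY_eq]
  have e1 : a * 2 ^ (j + d) + u = u + a * 2 ^ d * 2 ^ j := by ring
  rw [e1, Nat.add_mul_div_right _ _ (Nat.two_pow_pos j), Nat.add_mul_mod_self_right]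
  ring

/-- The insertions `insY (code u) j`, `j = 0..|u|`, are a permutation of the codes of `y ш u`.
[folklore] -/
theorem insYE4_perm : ∀ u : List Bool,
    List.Perm ((List.range (u.length + 1)).map fun j => LinEDS.insY (LinEDS.code u) j)
      ((MZV.shuffleWord [true] u).map LinEDS.code)
  | [] => by simp [LinEDS.insY, LinEDS.code]
  | b :: u => by
    have ih := insYE4_perm u
    have hB : ∀ j ∈ List.range (u.length + 1),
        LinEDS.insY (LinEDS.code (b :: u)) j =
          b.toNat * 2 ^ (u.length + 1) + LinEDS.insY (LinEDS.code u) j := fun j hj => by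
      rw [code_cons]
      exact insYE4_insY_add _ _ _ _ (by simpa [Nat.lt_succ_iff] using hj)
    have hC : ∀ v ∈ MZV.shuffleWord [true] u,
        LinEDS.code (b :: v) = b.toNat * 2 ^ (u.length + 1) + LinEDS.code v := fun v hv => by
      rw [code_cons, MZV.length_of_mem_shuffleWord [true] u hv, List.length_singleton,
        Nat.add_comm 1]
    have htop :
        LinEDS.insY (LinEDS.code (b :: u)) (u.length + 1) = LinEDS.code (true :: b :: u) := by
      rw [insYE4_insY_of_lt (by simpa using code_lt (b :: u)), code_cons true]
      simp
    have e1 : (List.range (u.length + 1)).map (fun j => LinEDS.insY (LinEDS.code (b :: u)) j) =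
        ((List.range (u.length + 1)).map fun j => LinEDS.insY (LinEDS.code u) j).map
          (fun x => b.toNat * 2 ^ (u.length + 1) + x) := by
      rw [List.map_map]
      exact List.map_congr_left hB
    have e2 : ((MZV.shuffleWord [true] u).map (List.cons b)).map LinEDS.code =
        ((MZV.shuffleWord [true] u).map LinEDS.code).map
          (fun x => b.toNat * 2 ^ (u.length + 1) + x) := by
      rw [List.map_map, List.map_map]
      exact List.map_congr_left hC
    rw [List.length_cons, List.range_succ, List.map_append, List.map_singleton, htop,
      MZV.shuffleWord_cons_cons, MZV.shuffleWord_nil_left, List.map_singleton, List.map_append,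
      List.map_singleton, List.singleton_append, e1, e2]
    exact (List.perm_append_singleton _ _).trans ((ih.map _).cons _)

/-- **E4 — insertions are the shuffle with `y`.** The codes `insY (code u) j`, `j = 0..|u|`, are,
with multiplicity, the codes of the words of `y ш u` (`MZV.shuffleWord [true] u`). [folklore] -/
theorem stub_insY_count :
    ∀ (u : List Bool) (c : ℕ),
      ((List.range (u.length + 1)).countP fun j => decide (LinEDS.insY (LinEDS.code u) j = c)) =
        (MZV.shuffleWord [true] u).countP fun v => decide (LinEDS.code v = c) := by
  intro u c
  have h := (insYE4_perm u).countP_eq (fun x => decide (x = c))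
  rw [List.countP_map, List.countP_map] at h
  exact h

end Summit.KontsevichZagierPeriods.FurushoPentagon.KernelModuloPeriodConjecture
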